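import Literature.NumberTheory.Automorphic.GLnLeviOrbitalDescent   -- ★ p837124 (D-S1c) `exists_lintegral_descConj_eq_mul_lintegral_levi`
import HarnessLib

/-!
# Parabolic descent of orbital integrals on `GL_n(F)`, BOCHNER form: the push-forward identity
# `(y ↦ y p y⁻¹)_* μ_{G∕T} = C‖det(1−K_p)‖⁻¹‖det K_p‖ · ((z,(k,u)) ↦ k (z p z⁻¹ u) k⁻¹)_* (μ_{M∕T} ⊗ κ ⊗ μ_U)` and
# `∫_{G∕T} φ(y p y⁻¹) = C‖det(1−K_p)‖⁻¹‖det K_p‖ ∫_{M∕T} ∫_{K×U_c} φ(k (m p m⁻¹ u) k⁻¹)` for Banach-valued integrable `φ`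

Topic `NumberTheory/Automorphic`; namespace `Literature.NumberTheory.Automorphic`.  KERNEL mathematics only: theorems, no definition,
no named fact, no instance, no notation, no `sorry`.  Cell `pub/hodgecm-mathlib`, F0∕P3a road «D-N6s» (N6 = local transfer at a place SPLIT in
`L`, by parabolic descent; peer cut F0P3a-p03 (g9) ∕ F0P3-p01 (g11) 2026-08-31: this is brick «B2b» = items (iv)+(vi) of the two censuses).

★ D-S1c (`GLnLeviOrbitalDescent`, [Rogawski1990 Lemma 4.13.1 (a) pp. 69–70]) proves, for `ℝ≥0∞`-valued Borel `F` on `G = GL_n(F)`, `M = M_c` a standard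
two-block Levi, `T ≤ M` closed centralising `p ∈ M` with `det(1 − K_p) ≠ 0` (`K_p = Ad(p)|_𝔫`):
`∫⁻_{G ⧸ T} F(y p y⁻¹) dμ_{G∕T} = C ‖det(1−K_p)‖⁻¹ ‖det K_p‖ ∫⁻_{M ⧸ T} ∫⁻_{K × U_c} F(k (m p m⁻¹ u) k⁻¹) d(κ ⊗ μ_U) dμ_{M∕T}` with ONE `C ∈ (0,∞)`.
This file reads it for BOCHNER integrals — the currency of the tree's orbital integrals `orbitalIntegral γ f m = ∫ descConj …` and of the
transfer relation ★ `IsDeltaTransferRel` (complex-valued test functions):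
* `exists_map_descConj_eq_smul_map_levi` — **the identity of push-forward measures on `GL_n(F)`** (the lintegral identity on indicators + `Measure.ext`):
  `μ_{G∕T}.map (y ↦ y p y⁻¹) = (C‖det(1−K_p)‖⁻¹‖det K_p‖) • (μ_{M∕T} ⊗ (κ ⊗ μ_U)).map ((z,(k,u)) ↦ k ((z p z⁻¹) u) k⁻¹)`;
* **`exists_integral_descConj_eq_smul_integral_levi`** — for `φ : GL_n(F) → E` continuous (`E` a Banach space) with `y ↦ φ(y p y⁻¹)` integrable on
  `G ⧸ T`: the `M ⧸ T`-integrand `z ↦ ∫_{K×U_c} φ(k ((z p z⁻¹) u) k⁻¹)` is integrable and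
  `∫_{G∕T} φ(y p y⁻¹) dμ_{G∕T} = (C‖det(1−K_p)‖⁻¹‖det K_p‖).toReal • ∫_{M∕T} ∫_{K×U_c} φ(k ((m p m⁻¹) u) k⁻¹) d(κ ⊗ μ_U) dμ_{M∕T}`
  (`integral_map`, `integral_smul_measure`, Fubini; integrability on the product from the measure identity) — print's
  «`Φ^G(γ, f) = |D_{G∕M}(γ)|^{−1∕2} Φ^M(γ, f̄^P)`» up to the measure dictionary `‖det(1−K)‖⁻¹‖det K‖ = |D_{G∕M}|^{−1∕2} δ_P^{1∕2}`;
* `integral_descConj_smul_of_forall_conj` — **a conjugation-invariant scalar weight slips through the orbital integral**: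
  `∫ descConj p T (ψ • φ) = ψ p • ∫ descConj p T φ` whenever `ψ(y p y⁻¹) = ψ p` (any measure; e.g. `ψ = τ_v · δ_P^{1∕2}`, a character of `M`, on the `M`-side).
HONEST LABEL: HC_CM is proved only modulo the printed citations until rung 0 closes; this file proves none of them (kernel brick of the PAYABLE split-place clause of N6).

## References
* [Rogawski1990] J. D. Rogawski, *Automorphic Representations of Unitary Groups in Three Variables*, Ann. of Math. Stud. 123 (1990), §4.13 Lemma 4.13.1 (a), pp. 69–70; §4.9 p. 55.
* [Folland1995] G. B. Folland, *A Course in Abstract Harmonic Analysis* (1995), §2.6 Thm. 2.49 (Weil's formula).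
-/

noncomputable section

open scoped MatrixGroups NNReal ENNReal
open MeasureTheory Measure Matrix Topology

namespace Literature.NumberTheory.Automorphic

open Literature.MeasureTheory.Group
open Literature.NumberTheory.GaloisRepresentations.IsNonarchimedeanLocalField

/-! ### §0 A conjugation-invariant scalar weight slips through `descConj` integrals (any group, any measure) -/

section Weight

variable {G : Type*} [Group G] (γ : G) (T : Subgroup G) (hT : ∀ t ∈ T, t * γ = γ * t)
  {𝕜 : Type*} [RCLike 𝕜] {E : Type*} [NormedAddCommGroup E] [NormedSpace 𝕜 E]

/-- `descConj (ψ • φ) = ψ γ • descConj φ` when `ψ` is constant on the orbit of `γ` (the integrand form of «a class function slips through the orbital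
integral», [Rogawski1990 §4.13 p. 69: `|D|^{1∕2}`, `δ_P^{1∕2}` and `τ` move through `Φ^M`]). [cite: Rogawski1990, §4.13 Lemma 4.13.1 (a) p. 69] -/
theorem descConj_smul_of_forall_conj (ψ : G → 𝕜) (hψ : ∀ y : G, ψ (y * γ * y⁻¹) = ψ γ) (φ : G → E) :
    descConj γ T hT (fun g => ψ g • φ g) = fun y => ψ γ • descConj γ T hT φ y := by
  funext y
  induction y using QuotientGroup.induction_on with
  | H g => rw [descConj_mk, descConj_mk, hψ]

/-- **A conjugation-invariant scalar weight slips through the orbital integral**: `∫ descConj γ T (ψ • φ) dμ = ψ γ • ∫ descConj γ T φ dμ`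
for `ψ(y γ y⁻¹) = ψ γ` (e.g. a class function, or a character of a subgroup containing the orbit). [cite: Rogawski1990, §4.13 Lemma 4.13.1 (a) p. 69] -/
theorem integral_descConj_smul_of_forall_conj [NormedSpace ℝ E] [CompleteSpace E] [MeasurableSpace (G ⧸ T)] (μ : Measure (G ⧸ T)) (ψ : G → 𝕜)
    (hψ : ∀ y : G, ψ (y * γ * y⁻¹) = ψ γ) (φ : G → E) :
    ∫ y, descConj γ T hT (fun g => ψ g • φ g) y ∂μ = ψ γ • ∫ y, descConj γ T hT φ y ∂μ := by
  rw [descConj_smul_of_forall_conj γ T hT ψ hψ φ, integral_smul]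

end Weight

/-! ### §1 The push-forward identity on `GL_n(F)` -/

section Descent

variable (F : Type*) [Field F] [ValuativeRel F] [TopologicalSpace F] [IsNonarchimedeanLocalField F]
  [MeasurableSpace F] [BorelSpace F]
  {n : ℕ} {c : Fin n → Bool} [MeasurableSpace (GL (Fin n) F)] [BorelSpace (GL (Fin n) F)]

/-- **The identity of push-forward measures behind the parabolic descent** (★ D-S1c read on indicators): with the binders of
★ `exists_lintegral_descConj_eq_mul_lintegral_levi` there is ONE `C ∈ (0, ∞)` such that for every admissible `p`,
`μ_{G∕T}.map (y ↦ y p y⁻¹) = (C‖det(1−K_p)‖⁻¹‖det K_p‖) • (μ_{M∕T} ⊗ (κ ⊗ μ_U)).map ((z,(k,u)) ↦ k ((z p z⁻¹) u) k⁻¹)` as measures on `GL_n(F)`.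
[cite: Rogawski1990, §4.13, Lemma 4.13.1 (a), pp. 69–70] [cite: Folland1995, §2.6 Thm. 2.49] -/
theorem exists_map_descConj_eq_smul_map_levi (hc : Monotone c)
    {M : Subgroup (GL (Fin n) F)} (hM : M = standardLeviGL F c)
    {T : Subgroup (GL (Fin n) F)} (hT : IsClosed (T : Set (GL (Fin n) F))) (hTM : T ≤ M)
    [MeasurableSpace (GL (Fin n) F ⧸ T)] [BorelSpace (GL (Fin n) F ⧸ T)]
    [MeasurableSpace (GL (Fin n) F ⧸ M)] [BorelSpace (GL (Fin n) F ⧸ M)]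
    [MeasurableSpace (↥M ⧸ T.subgroupOf M)] [BorelSpace (↥M ⧸ T.subgroupOf M)]
    (μGT : Measure (GL (Fin n) F ⧸ T)) [SMulInvariantMeasure (GL (Fin n) F) (GL (Fin n) F ⧸ T) μGT]
    [IsFiniteMeasureOnCompacts μGT] (hGT : μGT ≠ 0)
    (μGM : Measure (GL (Fin n) F ⧸ M)) [SMulInvariantMeasure (GL (Fin n) F) (GL (Fin n) F ⧸ M) μGM]
    [IsFiniteMeasureOnCompacts μGM] (hGM : μGM ≠ 0)
    (μMT : Measure (↥M ⧸ T.subgroupOf M)) [SMulInvariantMeasure ↥M (↥M ⧸ T.subgroupOf M) μMT]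
    [IsFiniteMeasureOnCompacts μMT] [SFinite μMT] (hMT : μMT ≠ 0)
    (κ : Measure ↥(glInt n F)) [IsHaarMeasure κ]
    (μN : Measure ↥(unipotentRadicalGL F c)) [IsHaarMeasure μN] [SFinite μN] :
    ∃ C : ℝ≥0∞, C ≠ 0 ∧ C ≠ ∞ ∧ ∀ (p : standardParabolicGL F c) (hpM : (p : GL (Fin n) F) ∈ M)
      (hpT : ∀ t ∈ T, t * (p : GL (Fin n) F) = (p : GL (Fin n) F) * t)
      (_hp : (1 - Matrix.of fun q q' : {i : Fin n // c i = false} × {j : Fin n // c j = true} =>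
          ((p : GL (Fin n) F) : Matrix (Fin n) (Fin n) F) q.1 q'.1 *
            (((p⁻¹ : standardParabolicGL F c) : GL (Fin n) F) : Matrix (Fin n) (Fin n) F) q'.2 q.2).det
          ≠ 0),
      μGT.map (descConj (p : GL (Fin n) F) T hpT id) =
        (C * ((normAbs F ((1 - Matrix.of
              fun q q' : {i : Fin n // c i = false} × {j : Fin n // c j = true} =>
                ((p : GL (Fin n) F) : Matrix (Fin n) (Fin n) F) q.1 q'.1 *
                  (((p⁻¹ : standardParabolicGL F c) : GL (Fin n) F) : Matrix (Fin n) (Fin n) F)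
                    q'.2 q.2).det)⁻¹ *
            normAbs F (Matrix.of
              fun q q' : {i : Fin n // c i = false} × {j : Fin n // c j = true} =>
                ((p : GL (Fin n) F) : Matrix (Fin n) (Fin n) F) q.1 q'.1 *
                  (((p⁻¹ : standardParabolicGL F c) : GL (Fin n) F) : Matrix (Fin n) (Fin n) F)
                    q'.2 q.2).det : ℝ≥0) : ℝ≥0∞)) •
        (μMT.prod (κ.prod μN)).map (fun zq : (↥M ⧸ T.subgroupOf M) × (↥(glInt n F) × ↥(unipotentRadicalGL F c)) =>
          (zq.2.1 : GL (Fin n) F) *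
            ((descConj (⟨(p : GL (Fin n) F), hpM⟩ : ↥M) (T.subgroupOf M)
                (fun t ht => Subtype.ext (hpT (t : GL (Fin n) F) ht)) Subtype.val zq.1) * (zq.2.2 : GL (Fin n) F)) *
          (zq.2.1 : GL (Fin n) F)⁻¹) := by
  obtain ⟨C, hC0, hCtop, hdesc⟩ := exists_lintegral_descConj_eq_mul_lintegral_levi F hc hM hT hTM μGT hGT μGM hGM μMT hMT κ μN
  refine ⟨C, hC0, hCtop, fun p hpM hpT hp => ?_⟩
  subst hM
  haveI : T2Space F := (isLocalField F).toT2Space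
  haveI : SecondCountableTopology F := secondCountableTopology_localField F
  haveI : SecondCountableTopology (Matrix (Fin n) (Fin n) F) := inferInstanceAs (SecondCountableTopology (Fin n → Fin n → F))
  haveI : SecondCountableTopology (Matrix (Fin n) (Fin n) F)ᵐᵒᵖ := MulOpposite.opHomeomorph.symm.secondCountableTopology
  haveI : SecondCountableTopology (GL (Fin n) F) := Units.isEmbedding_embedProduct.secondCountableTopology
  haveI : BorelSpace ↥(unipotentRadicalGL F c) := Subtype.borelSpace _
  haveI : BorelSpace ↥(glInt n F) := Subtype.borelSpace _
  haveI : CompactSpace ↥(glInt n F) := isCompact_iff_compactSpace.1 (isCompact_glInt n F)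
  haveI : IsFiniteMeasure κ := CompactSpace.isFiniteMeasure
  set pM : ↥(standardLeviGL F c) := ⟨(p : GL (Fin n) F), hpM⟩ with hpMdef
  set Ψ : (↥(standardLeviGL F c) ⧸ T.subgroupOf (standardLeviGL F c)) × (↥(glInt n F) × ↥(unipotentRadicalGL F c)) → GL (Fin n) F :=
    fun zq => (zq.2.1 : GL (Fin n) F) *
      ((descConj pM (T.subgroupOf (standardLeviGL F c)) (fun t ht => Subtype.ext (hpT (t : GL (Fin n) F) ht)) Subtype.val zq.1) *
        (zq.2.2 : GL (Fin n) F)) * (zq.2.1 : GL (Fin n) F)⁻¹ with hΨdef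
  -- the two structure maps are measurable
  have hf : Measurable (descConj (p : GL (Fin n) F) T hpT id) := measurable_descConj _ _ _ measurable_id
  have hval : Measurable (descConj pM (T.subgroupOf (standardLeviGL F c)) (fun t ht => Subtype.ext (hpT (t : GL (Fin n) F) ht)) Subtype.val) :=
    measurable_descConj _ _ _ measurable_subtype_coe
  have hΨ : Measurable Ψ :=
    ((measurable_subtype_coe.comp (measurable_fst.comp measurable_snd)).mul
      ((hval.comp measurable_fst).mul (measurable_subtype_coe.comp (measurable_snd.comp measurable_snd)))).mul
      (measurable_subtype_coe.comp (measurable_fst.comp measurable_snd)).inv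
  -- the value of `descConj … Subtype.val` is the coercion of the value of `descConj … id`
  have hvz : ∀ z, descConj pM (T.subgroupOf (standardLeviGL F c)) (fun t ht => Subtype.ext (hpT (t : GL (Fin n) F) ht)) Subtype.val z =
      ((descConj pM (T.subgroupOf (standardLeviGL F c)) (fun t ht => Subtype.ext (hpT (t : GL (Fin n) F) ht)) id z : ↥(standardLeviGL F c)) :
        GL (Fin n) F) := fun z => by
    induction z using QuotientGroup.induction_on
    rfl
  refine Measure.ext fun s hs => ?_
  rw [Measure.map_apply hf hs, Measure.smul_apply, Measure.map_apply hΨ hs, smul_eq_mul,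
    ← lintegral_indicator_one (hf hs), ← lintegral_indicator_one (hΨ hs)]
  -- the lintegral identity at `F := 1_s`
  have h1 := hdesc p hpM hpT hp (s.indicator 1) (measurable_one.indicator hs)
  have hL : (fun y => descConj (p : GL (Fin n) F) T hpT (s.indicator (1 : GL (Fin n) F → ℝ≥0∞)) y) =
      (descConj (p : GL (Fin n) F) T hpT id ⁻¹' s).indicator 1 := by
    funext y
    rw [descConj_eq_comp]
    by_cases h : descConj (p : GL (Fin n) F) T hpT id y ∈ s
    · simp [Set.indicator, h]
    · simp [Set.indicator, h]
  have hR : (Ψ ⁻¹' s).indicator (1 : (↥(standardLeviGL F c) ⧸ T.subgroupOf (standardLeviGL F c)) × (↥(glInt n F) × ↥(unipotentRadicalGL F c)) → ℝ≥0∞) =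
      fun a => s.indicator (1 : GL (Fin n) F → ℝ≥0∞) (Ψ a) := by
    funext a
    by_cases h : Ψ a ∈ s
    · simp [Set.indicator, h]
    · simp [Set.indicator, h]
  rw [hL] at h1
  have hae : AEMeasurable (fun a => s.indicator (1 : GL (Fin n) F → ℝ≥0∞) (Ψ a)) (μMT.prod (κ.prod μN)) :=
    ((measurable_one.indicator hs).comp hΨ).aemeasurable
  rw [h1, hR, lintegral_prod _ hae]
  congr 1
  refine lintegral_congr fun z => ?_
  rw [descConj_eq_comp _ _ _ (fun m : ↥(standardLeviGL F c) => ∫⁻ q : ↥(glInt n F) × ↥(unipotentRadicalGL F c),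
    s.indicator (1 : GL (Fin n) F → ℝ≥0∞) ((q.1 : GL (Fin n) F) * ((m : GL (Fin n) F) * (q.2 : GL (Fin n) F)) * (q.1 : GL (Fin n) F)⁻¹) ∂(κ.prod μN))]
  simp only [Function.comp_apply, hΨdef, hvz]
  rfl

/-- **PARABOLIC DESCENT OF ORBITAL INTEGRALS, BOCHNER FORM** [Rogawski1990 Lemma 4.13.1 (a): `Φ^G(γ, f) = |D_{G∕M}(γ)|^{−1∕2} Φ^M(γ, f̄^P)`].
Same binders and the same `C` as ★ D-S1c; for every admissible `p` and every CONTINUOUS `φ : GL_n(F) → E` (`E` Banach) whose orbital integrand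
`y ↦ φ(y p y⁻¹)` is integrable on `G ⧸ T`: the `M ⧸ T`-integrand `z ↦ ∫_{K×U_c} φ(k ((z p z⁻¹) u) k⁻¹) d(κ ⊗ μ_U)` is integrable, and
`∫_{G∕T} φ(y p y⁻¹) dμ_{G∕T} = (C‖det(1−K_p)‖⁻¹‖det K_p‖).toReal • ∫_{M∕T} ∫_{K×U_c} φ(k ((m p m⁻¹) u) k⁻¹) d(κ ⊗ μ_U) dμ_{M∕T}`.
[cite: Rogawski1990, §4.13, Lemma 4.13.1 (a), pp. 69–70] [cite: Folland1995, §2.6 Thm. 2.49] -/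
theorem exists_integral_descConj_eq_smul_integral_levi (hc : Monotone c)
    {M : Subgroup (GL (Fin n) F)} (hM : M = standardLeviGL F c)
    {T : Subgroup (GL (Fin n) F)} (hT : IsClosed (T : Set (GL (Fin n) F))) (hTM : T ≤ M)
    [MeasurableSpace (GL (Fin n) F ⧸ T)] [BorelSpace (GL (Fin n) F ⧸ T)]
    [MeasurableSpace (GL (Fin n) F ⧸ M)] [BorelSpace (GL (Fin n) F ⧸ M)]
    [MeasurableSpace (↥M ⧸ T.subgroupOf M)] [BorelSpace (↥M ⧸ T.subgroupOf M)]
    (μGT : Measure (GL (Fin n) F ⧸ T)) [SMulInvariantMeasure (GL (Fin n) F) (GL (Fin n) F ⧸ T) μGT]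
    [IsFiniteMeasureOnCompacts μGT] (hGT : μGT ≠ 0)
    (μGM : Measure (GL (Fin n) F ⧸ M)) [SMulInvariantMeasure (GL (Fin n) F) (GL (Fin n) F ⧸ M) μGM]
    [IsFiniteMeasureOnCompacts μGM] (hGM : μGM ≠ 0)
    (μMT : Measure (↥M ⧸ T.subgroupOf M)) [SMulInvariantMeasure ↥M (↥M ⧸ T.subgroupOf M) μMT]
    [IsFiniteMeasureOnCompacts μMT] [SFinite μMT] (hMT : μMT ≠ 0)
    (κ : Measure ↥(glInt n F)) [IsHaarMeasure κ]
    (μN : Measure ↥(unipotentRadicalGL F c)) [IsHaarMeasure μN] [SFinite μN] :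
    ∃ C : ℝ≥0∞, C ≠ 0 ∧ C ≠ ∞ ∧ ∀ (p : standardParabolicGL F c) (hpM : (p : GL (Fin n) F) ∈ M)
      (hpT : ∀ t ∈ T, t * (p : GL (Fin n) F) = (p : GL (Fin n) F) * t)
      (_hp : (1 - Matrix.of fun q q' : {i : Fin n // c i = false} × {j : Fin n // c j = true} =>
          ((p : GL (Fin n) F) : Matrix (Fin n) (Fin n) F) q.1 q'.1 *
            (((p⁻¹ : standardParabolicGL F c) : GL (Fin n) F) : Matrix (Fin n) (Fin n) F) q'.2 q.2).det
          ≠ 0)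
      {E : Type*} [NormedAddCommGroup E] [NormedSpace ℝ E] [CompleteSpace E]
      (φ : GL (Fin n) F → E), Continuous φ → Integrable (descConj (p : GL (Fin n) F) T hpT φ) μGT →
      Integrable (descConj (⟨(p : GL (Fin n) F), hpM⟩ : ↥M) (T.subgroupOf M) (fun t ht => Subtype.ext (hpT (t : GL (Fin n) F) ht))
          (fun m : ↥M => ∫ q : ↥(glInt n F) × ↥(unipotentRadicalGL F c),
            φ ((q.1 : GL (Fin n) F) * ((m : GL (Fin n) F) * (q.2 : GL (Fin n) F)) * (q.1 : GL (Fin n) F)⁻¹) ∂(κ.prod μN))) μMT ∧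
      ∫ y, descConj (p : GL (Fin n) F) T hpT φ y ∂μGT =
        (C * ((normAbs F ((1 - Matrix.of
              fun q q' : {i : Fin n // c i = false} × {j : Fin n // c j = true} =>
                ((p : GL (Fin n) F) : Matrix (Fin n) (Fin n) F) q.1 q'.1 *
                  (((p⁻¹ : standardParabolicGL F c) : GL (Fin n) F) : Matrix (Fin n) (Fin n) F)
                    q'.2 q.2).det)⁻¹ *
            normAbs F (Matrix.of
              fun q q' : {i : Fin n // c i = false} × {j : Fin n // c j = true} =>
                ((p : GL (Fin n) F) : Matrix (Fin n) (Fin n) F) q.1 q'.1 *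
                  (((p⁻¹ : standardParabolicGL F c) : GL (Fin n) F) : Matrix (Fin n) (Fin n) F)
                    q'.2 q.2).det : ℝ≥0) : ℝ≥0∞)).toReal •
        ∫ z, descConj (⟨(p : GL (Fin n) F), hpM⟩ : ↥M) (T.subgroupOf M) (fun t ht => Subtype.ext (hpT (t : GL (Fin n) F) ht))
          (fun m : ↥M => ∫ q : ↥(glInt n F) × ↥(unipotentRadicalGL F c),
            φ ((q.1 : GL (Fin n) F) * ((m : GL (Fin n) F) * (q.2 : GL (Fin n) F)) * (q.1 : GL (Fin n) F)⁻¹) ∂(κ.prod μN)) z ∂μMT := by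
  obtain ⟨C, hC0, hCtop, hmap⟩ := exists_map_descConj_eq_smul_map_levi F hc hM hT hTM μGT hGT μGM hGM μMT hMT κ μN
  refine ⟨C, hC0, hCtop, fun p hpM hpT hp E _ _ _ φ hφc hφi => ?_⟩
  subst hM
  haveI : T2Space F := (isLocalField F).toT2Space
  haveI : SecondCountableTopology F := secondCountableTopology_localField F
  haveI : SecondCountableTopology (Matrix (Fin n) (Fin n) F) := inferInstanceAs (SecondCountableTopology (Fin n → Fin n → F))
  haveI : SecondCountableTopology (Matrix (Fin n) (Fin n) F)ᵐᵒᵖ := MulOpposite.opHomeomorph.symm.secondCountableTopology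
  haveI : SecondCountableTopology (GL (Fin n) F) := Units.isEmbedding_embedProduct.secondCountableTopology
  haveI : BorelSpace ↥(unipotentRadicalGL F c) := Subtype.borelSpace _
  haveI : BorelSpace ↥(glInt n F) := Subtype.borelSpace _
  haveI : CompactSpace ↥(glInt n F) := isCompact_iff_compactSpace.1 (isCompact_glInt n F)
  haveI : IsFiniteMeasure κ := CompactSpace.isFiniteMeasure
  -- names
  set w : ℝ≥0∞ := C * ((normAbs F ((1 - Matrix.of
              fun q q' : {i : Fin n // c i = false} × {j : Fin n // c j = true} =>
                ((p : GL (Fin n) F) : Matrix (Fin n) (Fin n) F) q.1 q'.1 *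
                  (((p⁻¹ : standardParabolicGL F c) : GL (Fin n) F) : Matrix (Fin n) (Fin n) F)
                    q'.2 q.2).det)⁻¹ *
            normAbs F (Matrix.of
              fun q q' : {i : Fin n // c i = false} × {j : Fin n // c j = true} =>
                ((p : GL (Fin n) F) : Matrix (Fin n) (Fin n) F) q.1 q'.1 *
                  (((p⁻¹ : standardParabolicGL F c) : GL (Fin n) F) : Matrix (Fin n) (Fin n) F)
                    q'.2 q.2).det : ℝ≥0) : ℝ≥0∞) with hw
  have hw0 : w ≠ 0 := by
    refine mul_ne_zero hC0 (ENNReal.coe_ne_zero.2 (mul_ne_zero ?_ ?_))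
    · rw [ne_eq, map_eq_zero]; exact inv_ne_zero hp
    · rw [ne_eq, map_eq_zero]
      exact left_ne_zero_of_mul_eq_one (det_boxAd_mul_det_boxAd_inv p)
  have hwtop : w ≠ ∞ := ENNReal.mul_ne_top hCtop ENNReal.coe_ne_top
  set f := descConj (p : GL (Fin n) F) T hpT id with hf
  set pM : ↥(standardLeviGL F c) := ⟨(p : GL (Fin n) F), hpM⟩ with hpMdef
  set Ψ : (↥(standardLeviGL F c) ⧸ T.subgroupOf (standardLeviGL F c)) × (↥(glInt n F) × ↥(unipotentRadicalGL F c)) → GL (Fin n) F :=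
    fun zq => (zq.2.1 : GL (Fin n) F) *
      ((descConj pM (T.subgroupOf (standardLeviGL F c)) (fun t ht => Subtype.ext (hpT (t : GL (Fin n) F) ht)) Subtype.val zq.1) *
        (zq.2.2 : GL (Fin n) F)) * (zq.2.1 : GL (Fin n) F)⁻¹ with hΨdef
  have hfm : Measurable f := measurable_descConj _ _ _ measurable_id
  have hval : Measurable (descConj pM (T.subgroupOf (standardLeviGL F c)) (fun t ht => Subtype.ext (hpT (t : GL (Fin n) F) ht)) Subtype.val) :=
    measurable_descConj _ _ _ measurable_subtype_coe
  have hΨm : Measurable Ψ :=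
    ((measurable_subtype_coe.comp (measurable_fst.comp measurable_snd)).mul
      ((hval.comp measurable_fst).mul (measurable_subtype_coe.comp (measurable_snd.comp measurable_snd)))).mul
      (measurable_subtype_coe.comp (measurable_fst.comp measurable_snd)).inv
  have hid : μGT.map f = w • (μMT.prod (κ.prod μN)).map Ψ := hmap p hpM hpT hp
  -- `φ ∘ f = descConj p T φ`, `φ ∘ Ψ` = the double integrand
  have hφf : descConj (p : GL (Fin n) F) T hpT φ = φ ∘ f := descConj_eq_comp _ _ _ φ
  have hφsm : ∀ ν : Measure (GL (Fin n) F), AEStronglyMeasurable φ ν := fun ν => hφc.aestronglyMeasurable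
  -- integrability of `φ` for the push-forward, hence of `φ ∘ Ψ` for the product measure
  have hI1 : Integrable φ (μGT.map f) := (integrable_map_measure (hφsm _) hfm.aemeasurable).2 (by rw [← hφf]; exact hφi)
  have hI2 : Integrable φ ((μMT.prod (κ.prod μN)).map Ψ) := by
    rw [hid, integrable_smul_measure hw0 hwtop] at hI1
    exact hI1
  have hI3 : Integrable (φ ∘ Ψ) (μMT.prod (κ.prod μN)) := (integrable_map_measure (hφsm _) hΨm.aemeasurable).1 hI2
  -- the `M ⧸ T`-integrand is `z ↦ ∫ (φ ∘ Ψ)(z, ·)`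
  have hinner : (descConj pM (T.subgroupOf (standardLeviGL F c)) (fun t ht => Subtype.ext (hpT (t : GL (Fin n) F) ht))
        (fun m : ↥(standardLeviGL F c) => ∫ q : ↥(glInt n F) × ↥(unipotentRadicalGL F c),
          φ ((q.1 : GL (Fin n) F) * ((m : GL (Fin n) F) * (q.2 : GL (Fin n) F)) * (q.1 : GL (Fin n) F)⁻¹) ∂(κ.prod μN))) =
      fun z => ∫ q, (φ ∘ Ψ) (z, q) ∂(κ.prod μN) := by
    have hvz : ∀ z, descConj pM (T.subgroupOf (standardLeviGL F c)) (fun t ht => Subtype.ext (hpT (t : GL (Fin n) F) ht)) Subtype.val z =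
        ((descConj pM (T.subgroupOf (standardLeviGL F c)) (fun t ht => Subtype.ext (hpT (t : GL (Fin n) F) ht)) id z : ↥(standardLeviGL F c)) :
          GL (Fin n) F) := fun z => by
      induction z using QuotientGroup.induction_on
      rfl
    rw [descConj_eq_comp _ _ _ (fun m : ↥(standardLeviGL F c) => ∫ q : ↥(glInt n F) × ↥(unipotentRadicalGL F c),
      φ ((q.1 : GL (Fin n) F) * ((m : GL (Fin n) F) * (q.2 : GL (Fin n) F)) * (q.1 : GL (Fin n) F)⁻¹) ∂(κ.prod μN))]
    funext z
    simp only [Function.comp_apply, hΨdef, hvz]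
  refine ⟨?_, ?_⟩
  · rw [hinner]
    exact hI3.integral_prod_left
  · calc ∫ y, descConj (p : GL (Fin n) F) T hpT φ y ∂μGT
        = ∫ y, φ (f y) ∂μGT := by rw [hφf]; rfl
      _ = ∫ x, φ x ∂(μGT.map f) := (integral_map hfm.aemeasurable (hφsm _)).symm
      _ = ∫ x, φ x ∂(w • (μMT.prod (κ.prod μN)).map Ψ) := by rw [hid]
      _ = w.toReal • ∫ x, φ x ∂((μMT.prod (κ.prod μN)).map Ψ) := integral_smul_measure φ w
      _ = w.toReal • ∫ zq, φ (Ψ zq) ∂(μMT.prod (κ.prod μN)) := by rw [integral_map hΨm.aemeasurable (hφsm _)]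
      _ = w.toReal • ∫ zq, (φ ∘ Ψ) zq ∂(μMT.prod (κ.prod μN)) := rfl
      _ = w.toReal • ∫ z, ∫ q, (φ ∘ Ψ) (z, q) ∂(κ.prod μN) ∂μMT := by rw [integral_prod _ hI3]
      _ = _ := by rw [← hinner]

end Descent

end Literature.NumberTheory.Automorphic

end
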